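import Mathlib
import HarnessLib

/-!
# `NoHeavyLowerTail` (stmt-CriticalPhenomena-4575) — fibres of the swap Φ have at most two elements (L5.2 of U1-PROOF.md)

Support file (prover `prim-gen-swap` gen 11; `--supports stmt-CriticalPhenomena-4575`).  No definitions, no named facts, no sorries.

Classes `X : ι` have port pairs `s(P X, P' X)` (pairwise distinct: `hnopar` as injectivity of the port-pair map), two classes are ADJACENT when
they share a port.  L5.2 of the seat memo U1-PROOF.md (blueprint B3): if a credit configuration `Z ∪ {A(d)}` is the Φ-image of a unit with hub
`X ∋ d`, then every class of `Z` is adjacent to `X`; as soon as some `Y ∈ Z` avoids the port `d`, the hub `X` contains `d` and a port of `Y`, so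
there are at most TWO candidates — the fibre of the swap has at most two elements, and two candidates together with `Y` form a triangle.

* `StarSet.swap_fibre_card_le_two`.
-/

namespace Summit.CriticalPhenomena.PercolationContinuityZ3.Theorems

open Finset
open scoped BigOperators

namespace StarSet

variable {ι V : Type*} [Fintype ι] [DecidableEq V]

/-- **L5.2 of U1-PROOF.md: at most two hubs are compatible with a swap target.**  The classes `X` containing the port `d` and sharing a port
with a fixed class `Y` that avoids `d` number at most two (port pairs being pairwise distinct). -/
theorem swap_fibre_card_le_two (P P' : ι → V) (hinj : Function.Injective fun X => (s(P X, P' X) : Sym2 V))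
    (d : V) (Y : ι) (hYd : P Y ≠ d ∧ P' Y ≠ d) :
    (univ.filter (fun X => (P X = d ∨ P' X = d) ∧
        (P X = P Y ∨ P X = P' Y ∨ P' X = P Y ∨ P' X = P' Y))).card ≤ 2 := by
  classical
  -- every such class has port pair `s(d, P Y)` or `s(d, P' Y)`
  have hsub : univ.filter (fun X => (P X = d ∨ P' X = d) ∧ (P X = P Y ∨ P X = P' Y ∨ P' X = P Y ∨ P' X = P' Y)) ⊆
      univ.filter (fun X => (s(P X, P' X) : Sym2 V) ∈ ({s(d, P Y), s(d, P' Y)} : Finset (Sym2 V))) := by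
    intro X hX
    simp only [mem_filter, mem_univ, true_and] at hX ⊢
    obtain ⟨hd, hY⟩ := hX
    simp only [mem_insert, mem_singleton, Sym2.eq_iff]
    rcases hd with h | h <;> rcases hY with h' | h' | h' | h'
    · exact absurd (h.symm.trans h') hYd.1.symm
    · exact absurd (h.symm.trans h') hYd.2.symm
    · exact Or.inl (Or.inl ⟨h, h'⟩)
    · exact Or.inr (Or.inl ⟨h, h'⟩)
    · exact Or.inl (Or.inr ⟨h', h⟩)
    · exact Or.inr (Or.inr ⟨h', h⟩)
    · exact absurd (h.symm.trans h') hYd.1.symm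
    · exact absurd (h.symm.trans h') hYd.2.symm
  refine le_trans (card_le_card hsub) ?_
  -- the port-pair map is injective, so the preimage of a 2-set has at most 2 elements
  calc (univ.filter (fun X => (s(P X, P' X) : Sym2 V) ∈ ({s(d, P Y), s(d, P' Y)} : Finset (Sym2 V)))).card
      ≤ (({s(d, P Y), s(d, P' Y)} : Finset (Sym2 V))).card := by
        refine card_le_card_of_injOn (fun X => (s(P X, P' X) : Sym2 V)) (fun X hX => ?_) (fun X _ X' _ h => hinj h)
        exact (mem_filter.1 (mem_coe.1 hX)).2
    _ ≤ 2 := card_le_two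

end StarSet

end Summit.CriticalPhenomena.PercolationContinuityZ3.Theorems
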